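import Literature.IUT.LogThetaLattice.LogWallRemarks
import Literature.IUT.LogVolume.UnitLogTorsionPowerCriterion
import Mathlib.NumberTheory.Padics.ProperSpace
import HarnessLib

/-!
# [IUTchIII] §1 Remark 1.4.1 (i) at the genuine `p`-adic logarithm: `log_p` versus an `N`-th power map
# (proof-only sequel of `LogWallRemarksProofs.lean`; theorems only, no `def`, no named fact)

Mochizuki, *Inter-universal Teichmüller theory III*, §1 Remark 1.4.1 (i), kurims manuscript (May 2020)
p. 46 l. 20–30, render `paper:url-4b091feeb646` read on the page [claim: Mochizuki2012, status: disputed]: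
"the various squares that appear in each of the log-theta-lattices … are far from being
[1-]commutative! Indeed, whereas the vertical arrows … are constructed by applying the various
logarithms at `v ∈ V̲` — i.e., which are defined by means of power series that depend, in an essential
way, on the local ring structures at `v ∈ V̲` — the horizontal arrows … are incompatible with these
local ring structures".

abc-iut cell, layer L6, row «§1-REMARKS-COVERAGE» (seat abc-iut-L6-t9).  `LogWallRemarksProofs.lean`
(p442132) instantiates abc-iut-L6-t1's schema `Rmk141_notCommutative` with the REAL exponential /
logarithm as vertical arrow.  This sequel replaces the vertical arrow by the cell's MODEL of the
log-link at `v ∈ V̲^non` — abc-iut-S1's `p`-adic logarithm `unitLog = log_p` on `ℚ_p` ([IUTchIII]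
Def 1.1 (i); junk value `0` off the units) — keeping as horizontal arrow an `N`-th power map with
`p ∤ N`, `N ≥ 2` (e.g. `N = j²`, `1 < j < p`, the exponents of the `Θ`-links on `q`-parameters).  At the
unit `w = 1 + p²`: `‖log_p w‖ = p⁻²` by the isometry of `log_p` near `1` (abc-iut-w5-d070's
`TorsionPowerCriterion.norm_unitLog_eq_norm_one_sub`, radius `p⁻²`, valid for EVERY prime since
`p⁻²·p^{1/(p−1)} < 1`), so `log_p(w^N) = N·log_p w` (`unitLog_pow`, abc-iut-S1) has norm `p⁻²` while
`(log_p w)^N` has norm `p^{-2N} < p⁻²`: NO square of the lattice commutes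
(`Rmk141_notCommutative_unitLog_pow`).  Kept in a separate module because of its `p`-adic imports.

HONEST FRAMING: an instance of a typed transcription of an expository remark at the cell's model of
ONE of the two arrows (the horizontal `Θ^{×μ}`-link itself is not a self-map of one carrier and is not
modelled here); nothing bears on [IUTchIII] Cor. 3.12; no side is taken.
-/

set_option autoImplicit false

noncomputable section

namespace Literature.IUT.LogThetaLattice

open Literature.IUT.LogVolume

variable (p : ℕ) [Fact p.Prime]

/-- The unit `1 + p² ∈ ℚ_p`: `‖1 − (1 + p²)‖ = (p²)⁻¹`. [folklore] -/
private theorem norm_one_sub_one_add_p_sq :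
    ‖(1 : ℚ_[p]) - (1 + (p : ℚ_[p]) ^ 2)‖ = ((p : ℝ) ^ 2)⁻¹ := by
  have : (1 : ℚ_[p]) - (1 + (p : ℚ_[p]) ^ 2) = -((p : ℚ_[p]) ^ 2) := by ring
  rw [this, norm_neg, norm_pow, Padic.norm_p, inv_pow]

/-- `1 + p²` is a unit of `ℤ_p`: `‖1 + p²‖ = 1` (ultrametric inequality, `‖p²‖ < 1 = ‖1‖`). [folklore] -/
private theorem norm_one_add_p_sq : ‖(1 : ℚ_[p]) + (p : ℚ_[p]) ^ 2‖ = 1 := by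
  have hp : 1 < (p : ℝ) := by exact_mod_cast (Fact.out : p.Prime).one_lt
  have hlt : ‖(p : ℚ_[p]) ^ 2‖ < ‖(1 : ℚ_[p])‖ := by
    rw [norm_pow, Padic.norm_p, norm_one, inv_pow]
    exact inv_lt_one_of_one_lt₀ (by nlinarith)
  rw [IsUltrametricDist.norm_add_eq_max_of_norm_ne_norm (ne_of_gt hlt), max_eq_left hlt.le, norm_one]

/-- **`‖log_p (1 + p²)‖ = p⁻²` for every prime `p`**: the radius `ρ = p⁻²` satisfies
`ρ·p^{1/(p−1)} ≤ p⁻²·p < 1`, so the isometry `‖log_p w‖ = ‖1 − w‖`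
(`TorsionPowerCriterion.norm_unitLog_eq_norm_one_sub`, abc-iut-w5-d070) applies at `w = 1 + p²`.
[cite: Koblitz1984, Ch. IV §1] -/
theorem norm_unitLog_one_add_p_sq :
    ‖unitLog ((1 : ℚ_[p]) + (p : ℚ_[p]) ^ 2)‖ = ((p : ℝ) ^ 2)⁻¹ := by
  have hp : 1 < (p : ℝ) := by exact_mod_cast (Fact.out : p.Prime).one_lt
  have hp0 : 0 < (p : ℝ) := by linarith
  have hθ : ((p : ℝ) ^ 2)⁻¹ * (p : ℝ) ^ (1 / ((p : ℝ) - 1)) < 1 := by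
    have h1 : (p : ℝ) ^ (1 / ((p : ℝ) - 1)) ≤ (p : ℝ) ^ (1 : ℝ) := by
      apply Real.rpow_le_rpow_of_exponent_le hp.le
      rw [div_le_one (by linarith)]
      linarith [show (2 : ℝ) ≤ p by exact_mod_cast (Fact.out : p.Prime).two_le]
    rw [Real.rpow_one] at h1
    have h2 : ((p : ℝ) ^ 2)⁻¹ * (p : ℝ) ^ (1 / ((p : ℝ) - 1)) ≤ ((p : ℝ) ^ 2)⁻¹ * p :=
      mul_le_mul_of_nonneg_left h1 (by positivity)
    refine lt_of_le_of_lt h2 ?_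
    rw [pow_two, mul_inv, mul_assoc, inv_mul_cancel₀ hp0.ne', mul_one]
    exact inv_lt_one_of_one_lt₀ hp
  rw [TorsionPowerCriterion.norm_unitLog_eq_norm_one_sub p hθ (norm_one_sub_one_add_p_sq p).le,
    norm_one_sub_one_add_p_sq]

/-- **IUTchIII:Rmk1.4.1(i)** (kurims p. 46 l. 20–30) at the GENUINE `p`-adic logarithm: abc-iut-L6-t1's
`Rmk141_notCommutative` on the constant lattice `X n m = ℚ_p` with vertical arrow abc-iut-S1's
`log_p = unitLog` (the cell's model of the log-link at `v ∈ V̲^non`, [IUTchIII] Def 1.1 (i)) and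
horizontal arrow the `N`-th power map, `2 ≤ N`, `p ∤ N`: NO square commutes — at the unit `1 + p²`,
`log_p((1+p²)^N) = N·log_p(1+p²)` has norm `p⁻²` but `(log_p(1+p²))^N` has norm `p^{-2N} < p⁻²`.
[claim: Mochizuki2012, status: disputed] (IUTchIII §1 Rmk 1.4.1 (i), kurims p.46) -/
theorem Rmk141_notCommutative_unitLog_pow {N : ℕ} (hN : 2 ≤ N) (hpN : p.Coprime N) :
    Rmk141_notCommutative (fun _ _ => ℚ_[p]) (fun _ _ x => unitLog x) (fun _ _ x => x ^ N) := by
  intro n m h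
  have hwu : ‖(1 : ℚ_[p]) + (p : ℚ_[p]) ^ 2‖ = 1 := norm_one_add_p_sq p
  have hsq : unitLog (((1 : ℚ_[p]) + (p : ℚ_[p]) ^ 2) ^ N)
      = (unitLog ((1 : ℚ_[p]) + (p : ℚ_[p]) ^ 2)) ^ N := h _
  rw [unitLog_pow p hwu N] at hsq
  have hnorm := congrArg (fun x : ℚ_[p] => ‖x‖) hsq
  simp only [norm_mul, norm_pow, Padic.norm_natCast_eq_one_iff.mpr hpN, one_mul,
    norm_unitLog_one_add_p_sq p] at hnorm
  have hp : 1 < (p : ℝ) := by exact_mod_cast (Fact.out : p.Prime).one_lt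
  have ha0 : 0 < ((p : ℝ) ^ 2)⁻¹ := by positivity
  have ha1 : ((p : ℝ) ^ 2)⁻¹ < 1 := inv_lt_one_of_one_lt₀ (by nlinarith)
  have hlt : (((p : ℝ) ^ 2)⁻¹) ^ N < ((p : ℝ) ^ 2)⁻¹ := pow_lt_self_of_lt_one₀ ha0 ha1 (by omega)
  exact absurd hnorm (ne_of_lt hlt).symm

end Literature.IUT.LogThetaLattice

end
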